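import Literature.Analysis.FluidPDE.LerayHopf
import Literature.Analysis.FluidPDE.SuitableWeak
import HarnessLib

/-!
# `L³` concentration at the similarity scale near a Type-I singularity (Barker–Prange 2020, Thm. 2)

Topic `Analysis/FluidPDE`. Source: T. Barker, C. Prange, *Localized smoothing for the
Navier–Stokes equations and concentration of critical norms near singularities*, Arch. Ration.
Mech. Anal. 236 (2020), 1487–1541 = arXiv:1812.09115 [BarkerPrange2020]; read in the arXiv
version, §1 ("Concentration of norms centered on singularities", pp. 4–5: definitions of regular /
singular points and blow-up times, the Type I bound (1.7) = `(e.typeI)`, **Theorem 2** and the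
remarks after it) and §4.2 (proof of Theorem 2, p. 16).

**The printed statement** (unit viscosity, no force, `ℝ³ × (0, ∞)`). *Theorem 1* supplies, for
every `M ∈ (0, ∞)`, a time `S*(M) ∈ (0, ¼]` and "an independent universal constant `γ_univ`".
*Theorem 2:* "Let `γ_univ`, `M ∈ (0, ∞)` and `S*(M)` given by Theorem 1. Let `T* ∈ (0, ∞)` and
`r₀ ∈ (0, ∞]` be fixed. There exists `t_*(T*, M, r₀) ∈ [0, ∞)` such that the following holds true.
Let `u` be a Leray–Hopf solution to (NSE) in `ℝ³ × (0, ∞)` satisfying the type I bound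
`sup_{x̄ ∈ ℝ³} sup_{r ∈ (0, r₀)} sup_{T* - r² < t < T*} r^{-1/2} (∫_{B_r(x̄)} |u(x, t)|² dx)^{1/2}`
`≤ M`.
Furthermore, suppose `u` first blows-up at `T*` and has a singular point at the space-time point
`(0, T*)`. Then `‖u(·, t)‖_{L³(|·| ≤ 2√((T* - t)/S*(M)))} > γ_univ` for all `t ∈ (t_*, T*)`."
Remarks printed after it (p. 5): by translation invariance the conclusion holds at any blow-up
point `(x̄, T*)`; "if `r₀ = ∞`, `t_* = 0`". Definitions (p. 4): `(x̄, t) ∈ ℝ³ × (0, ∞)` is a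
*regular point* if `u ∈ L^∞(B_r(x̄) × (t - r², t))` for some `r ∈ (0, ∞)`, otherwise a *singular
(blow-up) point*; `T*` is a *blow-up time* if some `(x̄, T*)` is singular; "`u` first blows up at
`T*`" = `T*` is the least blow-up time.

## Contents

* `BarkerPrange2020_thm2` — the named fact (D-0014), transcribed below.

## Transcription notes

* *Viscosity.* Printed for `ν = 1`; recorded for `ν > 0` (the requesting route works with general
  `ν`), exactly as the tree does for `gkp_besov_blowup` / `albritton_singular_point_of_blowup`:
  apply the printed statement to `w(y, s) = ν⁻¹ u(y, s/ν)`, a unit-viscosity Leray–Hopf solution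
  with blow-up time `νT*`. Space is not rescaled, so the radii `r`, `r₀` and the balls are those of
  the source; times pick up the factor `ν⁻¹` (`T* - r²/ν < t < T*`), the Morrey bound reads
  `‖u(t)‖_{L²(B_r(x̄))} ≤ M ν √r`, the concentration ball has radius `2√(ν(T* - t)/S*(M))` and
  the threshold is `γ_univ ν`. Regular and singular points are unchanged (each family of cylinders
  `(t - r², t) × B_r`, `(t - r²/ν, t) × B_r`, `r ↓ 0`, is cofinal in the other).
* *"Leray–Hopf solution in `ℝ³ × (0, ∞)`"* = the tree's `IsGlobalLerayHopf ν 0 u₀ u`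
  (Leray–Hopf on `[0, T)` for every `T > 0`, strict sense: energy inequalities, weak `L²`
  continuity, strong attainment of the datum — at least the class of the source, p. 2).
* *Singular point at `(x̄₀, T*)`* (p. 4, backward cylinders) = essential unboundedness of
  `uncurry u` on `parabolicCylinder r (T*, x̄₀) = (T* - r², T*) × B_r(x̄₀)` for every `0 < r`,
  `r² < T*` — the convention of `albritton_singular_point_of_blowup` and
  `lemarieRieusset_singular_point_of_blowup` ("for all `r`" and "for all small `r`" agree by
  monotonicity of the cylinders). It is *not* replaced by `¬ IsRegularPoint u (T*, x̄₀)` (centred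
  cylinders, `SuitableWeak.lean`), which is a weaker hypothesis for a solution living past `T*`.
* *"`u` first blows up at `T*`"* = no point `(x̄, t)` with `0 < t < T*` is singular, i.e. every
  point of the open strip is regular; on the *open* strip regularity for backward cylinders and
  for centred ones (`IsRegularPoint`) coincide (a backward cylinder at a slightly later time is a
  neighbourhood), so the tree's `IsRegularPoint u (t, x)` is used.
* *`r₀ ∈ (0, ∞]`* is an extended non-negative real `r₀ : ℝ≥0∞` with `0 < r₀`; radii are real
  `r` with `0 < r`, `ofReal r < r₀`. Times in the Morrey bound are also required to be positive
  (`u` lives on `(0, ∞)`; for `r² > νT*` the printed range `T* - r² < t` leaves the domain).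
* *`t_*`.* Printed: "there exists `t_*(T*, M, r₀) ∈ [0, ∞)`", depending on `T*, M, r₀` only (not
  on `u`), with `t_* = 0` when `r₀ = ∞` (p. 5); the proof (§4.2) takes `t_* = T* - S*(M) r₀²`
  (∨ 0). Recorded as `∃ t_*, 0 ≤ t_* ∧ t_* < T* ∧ (r₀ = ∞ → t_* = 0)`, quantified before `u`: the
  clause `t_* < T*`, without which the statement would be void, is the content of the theorem
  ("for all `t ∈ (t_*, T*)`") and of its proof.
* Norms are Mathlib `eLpNorm` on restricted Lebesgue measure (`ℝ≥0∞`-valued, no Bochner junk):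
  `‖u(t)‖_{L²(B_r(x̄))} = eLpNorm (u t) 2 (volume.restrict (ball x̄ r))`, and the conclusion
  `γ ν < ‖u(t)‖_{L³(closedBall x̄₀ (2√(ν(T* - t)/S*)))}`.
* Recorded remark (p. 5, not part of the fact): the pointwise Type-I rate
  `√(T* - t) |u(x, t)| ≤ M'` implies the Morrey-type bound `(e.typeI)` only with some
  `r₀ ∈ (0, ∞)` and a constant `M(M', u₀, r)` depending on the solution (Seregin–Zajączkowski;
  Seregin 2018, pp. 844–849), whereas `|u(x, t)| ≤ M'/|x|` or a scale-critical Morrey bound give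
  `(e.typeI)` with `r₀ = ∞`, `M = M'`.
* Not here: Theorem 1 itself (localized smoothing for local energy solutions with locally
  critical data; it would need Lemarié-Rieusset local energy solutions), the `L^{3,∞}` and Besov
  variants (Appendices B, C), and the corollary `‖u(t)‖_{L³(B₁(0))} > γ_univ` on `[t_*, T*)`
  (p. 5). Mathlib has no Navier–Stokes notions; the tree's `IsGlobalLerayHopf`, `IsRegularPoint`,
  `parabolicCylinder` are used (searched `BarkerPrange`, `concentration`, `firstBlowup`: no prior
  transcription of this theorem).

## References

* T. Barker, C. Prange, ARMA 236 (2020) 1487–1541, doi:10.1007/s00205-020-01495-6 =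
  arXiv:1812.09115: Thm. 1 (p. 2), (1.7) and Thm. 2 (pp. 4–5), §4.2 (p. 16). [BarkerPrange2020]
* G. Seregin, *A note on weak solutions to the Navier–Stokes equations that are locally in
  `L_∞(L^{3,∞})`* (2018), pp. 844–849 (cited by the source for `(e.typeI)` from the Type-I rate).
-/

noncomputable section

open MeasureTheory Set Function Metric
open scoped ENNReal

namespace Literature.Analysis.FluidPDE

/-- **Barker–Prange 2020, Theorem 2: `L³` concentration at the similarity scale near a Type-I
singularity.** There is a universal `γ = γ_univ > 0`, and for every `M > 0` a time
`S = S*(M) ∈ (0, ¼]` (those of their Theorem 1), such that for every viscosity `ν > 0`, every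
`T = T* > 0` and every `r₀ ∈ (0, ∞]` there is `t_* = t_*(T, M, r₀) ∈ [0, T)` (`t_* = 0` if
`r₀ = ∞`) with the following property. Let `u` be a global Leray–Hopf weak solution of the
unforced Navier–Stokes equations with viscosity `ν` on `E³ × (0, ∞)` (`IsGlobalLerayHopf ν 0 u₀ u`)
satisfying the **Type-I (Morrey-type) bound** `‖u(t)‖_{L²(B_r(x̄))} ≤ M ν √r` for all centres
`x̄`, all radii `0 < r < r₀` and all times `max(0, T - r²/ν) < t < T` (the source's (1.7) with
`ν = 1`); suppose that `u` **first blows up at `T`** (every point `(t, x)` of the open strip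
`0 < t < T` is regular) and that `(T, x₀)` is a **singular point** (`u` is essentially unbounded
on every backward cylinder `(T - r², T) × B_r(x₀)`, `0 < r`, `r² < T`). Then for every
`t ∈ (t_*, T)`, `‖u(t)‖_{L³(|x - x₀| ≤ 2√(ν(T - t)/S))} > γ ν`. Printed for `ν = 1` at the
singular point `(0, T*)`, extended to any blow-up point by translation (p. 5) and to `ν > 0` by
`w(y, s) = ν⁻¹ u(y, s/ν)` (module docstring, *Transcription notes*).
[cite: BarkerPrange2020, Thm. 2 (arXiv:1812.09115, pp. 4–5)] -/
def BarkerPrange2020_thm2 : Prop :=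
  ∃ γ : ℝ, 0 < γ ∧ ∀ M : ℝ, 0 < M → ∃ S : ℝ, 0 < S ∧ S ≤ 1 / 4 ∧
    ∀ (ν T : ℝ), 0 < ν → 0 < T → ∀ r₀ : ℝ≥0∞, 0 < r₀ →
      ∃ tStar : ℝ, 0 ≤ tStar ∧ tStar < T ∧ (r₀ = ∞ → tStar = 0) ∧
        ∀ (u₀ : EuclideanSpace ℝ (Fin 3) → EuclideanSpace ℝ (Fin 3))
          (u : ℝ → EuclideanSpace ℝ (Fin 3) → EuclideanSpace ℝ (Fin 3)),
          IsGlobalLerayHopf ν 0 u₀ u →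
          (∀ (y : EuclideanSpace ℝ (Fin 3)) (r : ℝ), 0 < r → ENNReal.ofReal r < r₀ →
            ∀ t : ℝ, 0 < t → T - r ^ 2 / ν < t → t < T →
              eLpNorm (u t) 2 (volume.restrict (ball y r)) ≤ ENNReal.ofReal (M * ν * Real.sqrt r)) →
          (∀ t ∈ Ioo 0 T, ∀ x : EuclideanSpace ℝ (Fin 3), IsRegularPoint u (t, x)) →
          ∀ x₀ : EuclideanSpace ℝ (Fin 3),
            (∀ r : ℝ, 0 < r → r ^ 2 < T →
              eLpNorm (uncurry u) ∞ (volume.restrict (parabolicCylinder r (T, x₀))) = ∞) →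
            ∀ t ∈ Ioo tStar T,
              ENNReal.ofReal (γ * ν) <
                eLpNorm (u t) 3
                  (volume.restrict (closedBall x₀ (2 * Real.sqrt (ν * (T - t) / S))))

end Literature.Analysis.FluidPDE

end
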